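import Literature.MathematicalPhysics.StatisticalMechanics.LatticeMaximalFluctuations
import Literature.MathematicalPhysics.StatisticalMechanics.EIPLevelCount
import Literature.Algebra.EuclideanLattices.BallGridPointsOverlap
import Literature.Probability.LatticeModels.LatticeGraphProofs
import HarnessLib

/-!
# The maximal-fluctuation law on the cubic lattice `ℤ^d` in continuum (Voronoi) form:
# Cicalese–Leonardi 2020 §3.1 for exact minimisers, PROVED and SHARPENED via Mainini–Schmidt 2020

Topic `Literature/MathematicalPhysics/StatisticalMechanics`; bridges two typed stories of the tree:

* the **lattice-counting** edge-isoperimetric vocabulary of `EdgeIsoperimetricFluctuations.lean`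
  (`Site d = ℤ^d`, `boundaryPairs` = the edge perimeter `Θ_d`, `IsEIPMinimizer`, the lattice Wulff cube
  `wulffCube d n = {1,…,⌊n^{1/d}⌋}^d`, `maximalFluctuationExponent d = (d−1+2^{1−d})/d`) in which
  Mainini–Schmidt's Theorem 1.1 (i) is a tree THEOREM (`EIPLevelCount.MaininiSchmidt2020_thm11_upper_holds`:
  every `EIP^d` minimizer `C`, `#C = n`, satisfies `#((C − a) △ W_n) ≤ K_d n^{(d−1+2^{1−d})/d}` for some
  `a ∈ ℤ^d`), and
* the **continuum** vocabulary of Cicalese–Leonardi 2020 typed in `LatticeMaximalFluctuations.lean`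
  (namespace `CicaleseLeonardi2020`: `cubicLattice d = ℤ^d ⊂ ℝ^d`, the excess energy
  `cubicExcess X = Σ_{x∈X} val(x,X)`, almost-minimality `IsAlmostMinimal`, the Voronoi-cube union
  `cubeUnion X = V(X) = ⋃_{x∈X} x + [−½,½]^d`, the continuum Wulff cube `wulffCube d N = N^{1/d}[−½,½]^d`
  and the fluctuation `translationDeviation A W = inf_{x ∈ ℝ^d} |A △ (x + W)|`), in which §3.1 of the
  source is the NAMED FACT `CicaleseLeonardi2020_cubicLattice` (almost-minimisers) with the conditional
  corollary `cubicLattice_minimizers_of (h : CicaleseLeonardi2020_cubicLattice)` for exact minimisers.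

## Source, as printed

M. Cicalese, G. P. Leonardi, *Maximal fluctuations on periodic lattices: an approach via quantitative
Wulff inequalities*, Comm. Math. Phys. **375** (2020) 1931–1944 [CicaleseLeonardi2020], §3.1 p. 7 (held
text `paper:doi-10-1007-s00220-019-03612-3`, p0007): "In particular, in the case `α_N = 0` we get
`inf_{x∈ℝ^d} |V(X) △ (x + W_N)| ≤ c_d N^{1−1/(2d)}`.  Let us observe that, in dimension 2, we obtain the
optimal fluctuation estimate `N^{3/4}`.  However, in dimension `d ≥ 3` our method provides a sub-optimal
fluctuation estimate `N^{1−1/(2d)}`.  Indeed, we point out that the `N^{3/4}` law has been proved for the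
lattice `ℤ³` in [22]" (= Mainini–Piovano–Schmidt–Stefanelli 2019); and E. Mainini, B. Schmidt, *Maximal
fluctuations around the Wulff shape for edge-isoperimetric sets in ℤ^d: a sharp scaling law*, Comm. Math.
Phys. **380** (2020) 947–971 [MaininiSchmidt2020], Theorem 1.1 (i) (the sharp exponent
`(d−1+2^{1−d})/d` in every dimension).

## Contents (everything PROVED; no definition, no named fact is introduced)

* Bridge lemmas (reusing `Literature.Algebra.EuclideanLattices.intVec : (Fin d → ℤ) → ℝ^d`, whose range
  is `cubicLattice d` by `rfl`): `zdGraph_adj_iff_dist_intVec_eq_one` (lattice neighbours = lattice points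
  at Euclidean distance `1`), `CicaleseLeonardi2020.valence_image_intVec`,
  `CicaleseLeonardi2020.cubicExcess_image_intVec` (**`E(ι C) = #Θ_d(C)`**),
  `CicaleseLeonardi2020.exists_eq_image_intVec`,
  `CicaleseLeonardi2020.isAlmostMinimal_zero_iff_isEIPMinimizer` (**exact minimisers of `E` on `ℤ^d` =
  `EIP^d` minimizers**); volumes: `volume_setOf_forall_le_and_le` (coordinate boxes of `ℝ^d`),
  `CicaleseLeonardi2020.volume_unitCubeAt` (`= 1`), `CicaleseLeonardi2020.volume_cubeUnion_symmDiff_le`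
  (**`|V(X) △ V(Y)| ≤ #(X △ Y)`**), `volume_cubeUnion_latticeCube` (`|V(a + {1,…,ℓ}^d)| = ℓ^d`),
  `CicaleseLeonardi2020.volume_vadd_wulffCube` (`|x + W_N| = N`),
  `volume_cubeUnion_latticeCube_symmDiff_le` (`|V(a + {1,…,ℓ}^d) △ (v + W_N)| ≤ N − ℓ^d` for the
  concentric translate), `sub_latticeRootFloor_pow_le` (`N − ⌊N^{1/d}⌋^d ≤ d N^{(d−1+2^{1−d})/d}`),
  `rpow_maximalFluctuationExponent_le_rpow` (`(d−1+2^{1−d})/d ≤ 1 − 1/(2d)` for `d ≥ 2`).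
* `CicaleseLeonardi2020.cubicLattice_minimizers_sharp` — **for every `d ≥ 1` there is `c_d` with
  `inf_x |V(X) △ (x + W_N)| ≤ c_d N^{(d−1+2^{1−d})/d}` for every exact minimiser `X ⊂ ℤ^d`, `#X = N`**
  ([MaininiSchmidt2020] Theorem 1.1 (i) transported to Lebesgue measure).
* `CicaleseLeonardi2020.cubicLattice_minimizers` — **the printed `N^{1−1/(2d)}` law for exact minimisers
  (`d ≥ 2`), now UNCONDITIONAL** (same statement as the conclusion of `cubicLattice_minimizers_of`).
* `CicaleseLeonardi2020.cubicLattice_minimizers_three` — the `N^{3/4}` law on `ℤ³` in continuum form.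
* `CicaleseLeonardi2020.cubicLattice_minimizers_sharp_lower` — **sharpness in continuum form**
  ([MaininiSchmidt2020] Theorem 1.1 (ii) transported): for every `d ≥ 2` some `c > 0` and infinitely many
  `N` admit an exact minimiser `X ⊂ ℤ^d`, `#X = N`, with `inf_x |V(X) △ (x + W_N)| ≥ c N^{(d−1+2^{1−d})/d}`;
  via `card_symmDiff_le_volume_cubeUnion_symmDiff` (**`#(C △ B) ≤ |V(ι C) △ V(ι B)|`**, disjoint open
  Voronoi cubes) and `exists_volume_cubeUnion_latticeCube_symmDiff_vadd_le` (replacing the infimum over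
  `x ∈ ℝ^d` by lattice translations costs `≤ 4d(⌊N^{1/d}⌋ + 2)^{d−1} = O(N^{(d−1)/d})`).

WHAT IS NOT HERE: the named fact `CicaleseLeonardi2020_cubicLattice` itself (almost-minimisers,
`α_N > 0`) is NOT discharged — its printed proof rests on the Figalli–Maggi–Pratelli quantitative Wulff
inequality (typed as `Literature.Analysis.Convexity.FigalliMaggiPratelli2010_quantitativeWulff`) and on
the identity `P_1(V(X)) = E(X)` for the distributional `ℓ¹`-anisotropic perimeter, neither of which is
proved in the tree in dimension `d`; the honeycomb and triangular statements of the source (§3.2, §3.3)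
are untouched.

## References

* [CicaleseLeonardi2020] M. Cicalese, G. P. Leonardi, Comm. Math. Phys. 375 (2020) 1931–1944,
  doi:10.1007/s00220-019-03612-3, §3.1 p. 6–7.
* [MaininiSchmidt2020] E. Mainini, B. Schmidt, Comm. Math. Phys. 380 (2020) 947–971 = arXiv:2003.01679,
  Theorem 1.1 (i).
* [MaininiPiovanoSchmidtStefanelli2019] E. Mainini, P. Piovano, B. Schmidt, U. Stefanelli, *N^{3/4} law in
  the cubic lattice*, J. Stat. Phys. 176 (2019) 1480–1499, Theorem 1.1 (`d = 3`).
-/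

noncomputable section

open Finset MeasureTheory
open scoped symmDiff ENNReal Pointwise

namespace Literature.MathematicalPhysics.StatisticalMechanics

open Literature.Probability.LatticeModels
open Literature.Algebra.EuclideanLattices (intVec intVec_apply intVec_injective)

variable {d : ℕ}

/-! ### A: the cubic lattice `ℤ^d ⊂ ℝ^d` and its nearest-neighbour structure -/


/-- `ℤ^d ⊂ ℝ^d` of Cicalese–Leonardi is the range of the tree's embedding
`Literature.Algebra.EuclideanLattices.intVec` of integer vectors (definitionally).
[cite: CicaleseLeonardi2020, §3.1 p. 6 (`L = ℤ^d`)] -/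
theorem CicaleseLeonardi2020.cubicLattice_eq_range_intVec (d : ℕ) :
    CicaleseLeonardi2020.cubicLattice d = Set.range (intVec d) := rfl

/-- The squared Euclidean distance of two lattice points is `Σ_i (x_i − y_i)²`.
[cite: CicaleseLeonardi2020, §3 (3.16) p. 6 (neighbours at distance `1`)] -/
theorem dist_intVec_sq (x y : Site d) :
    dist (intVec d x) (intVec d y) ^ 2 = ∑ i, ((x i : ℝ) - y i) ^ 2 := by
  rw [EuclideanSpace.dist_eq, Real.sq_sqrt (Finset.sum_nonneg fun i _ => sq_nonneg _)]
  refine Finset.sum_congr rfl fun i _ => ?_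
  rw [intVec_apply, intVec_apply, Real.dist_eq, sq_abs]

/-- An integer whose square is at most one satisfies `|a| = a²`. [folklore] -/
private theorem abs_eq_sq_of_sq_le_one {a : ℤ} (h : a ^ 2 ≤ 1) : |a| = a ^ 2 := by
  have h1 : |a| ≤ 1 := by
    have : |a| ^ 2 ≤ 1 := by rwa [sq_abs]
    nlinarith [abs_nonneg a]
  rcases abs_le.mp h1 with ⟨h2, h3⟩
  interval_cases a <;> simp

/-- Two lattice points are at Euclidean distance `1` iff `Σ_i (x_i − y_i)² = 1` in `ℤ`.
[cite: CicaleseLeonardi2020, §3 (3.16) p. 6 (neighbours at distance `1`)] -/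
theorem dist_intVec_eq_one_iff_sum_sq (x y : Site d) :
    dist (intVec d x) (intVec d y) = 1 ↔ ∑ i, (x i - y i) ^ 2 = 1 := by
  have hcast : (∑ i, ((x i : ℝ) - y i) ^ 2) = ((∑ i, (x i - y i) ^ 2 : ℤ) : ℝ) := by
    push_cast
    rfl
  constructor
  · intro h
    have h2 := dist_intVec_sq x y
    rw [h, one_pow, hcast] at h2
    exact_mod_cast h2.symm
  · intro h
    have h2 := dist_intVec_sq x y
    rw [hcast, h, Int.cast_one] at h2
    have h3 : dist (intVec d x) (intVec d y) = 1 ∨ dist (intVec d x) (intVec d y) = -1 := by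
      have : (dist (intVec d x) (intVec d y) - 1) * (dist (intVec d x) (intVec d y) + 1) = 0 := by
        nlinarith [h2]
      rcases mul_eq_zero.mp this with h4 | h4
      · exact Or.inl (by linarith)
      · exact Or.inr (by linarith)
    rcases h3 with h3 | h3
    · exact h3
    · linarith [dist_nonneg (x := intVec d x) (y := intVec d y)]

/-- **Nearest neighbours of `ℤ^d` are the lattice points at Euclidean distance `1`**: the graph
`zdGraph d` (`‖x − y‖₁ = 1`, `zdGraph_adj_iff_norm_holds`) versus Cicalese–Leonardi's "`|y − x| = 1`"
in `ℝ^d` (3.16). [cite: CicaleseLeonardi2020, §3 (3.16) p. 6] -/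
theorem zdGraph_adj_iff_dist_intVec_eq_one (x y : Site d) :
    (zdGraph d).Adj x y ↔ dist (intVec d x) (intVec d y) = 1 := by
  rw [zdGraph_adj_iff_norm_holds x y, dist_intVec_eq_one_iff_sum_sq]
  constructor
  · intro h
    -- each |x i - y i| ≤ 1, hence equals its square
    have hle : ∀ i, |x i - y i| ≤ 1 := fun i => by
      rw [← h]
      exact Finset.single_le_sum (f := fun j => |x j - y j|) (fun j _ => abs_nonneg _) (mem_univ i)
    rw [← h]
    refine Finset.sum_congr rfl fun i _ => ?_
    have h1 := hle i
    have : (x i - y i) ^ 2 ≤ 1 := by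
      rw [← sq_abs]; nlinarith [abs_nonneg (x i - y i)]
    exact (abs_eq_sq_of_sq_le_one this).symm
  · intro h
    have hle : ∀ i, (x i - y i) ^ 2 ≤ 1 := fun i => by
      rw [← h]
      exact Finset.single_le_sum (f := fun j => (x j - y j) ^ 2) (fun j _ => sq_nonneg _) (mem_univ i)
    rw [← h]
    exact Finset.sum_congr rfl fun i _ => abs_eq_sq_of_sq_le_one (hle i)

/-- **The valence of a lattice point is its number of empty lattice neighbours**: for `C ⊂ ℤ^d` and
`z ∈ ℤ^d`, `val(ι z, ι C) = #{w ∼ z : w ∉ C}` ("`val(x, X) = #{y ∈ L ∖ X : |y − x| = 1}`").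
[cite: CicaleseLeonardi2020, §3 (3.16) p. 6] -/
theorem CicaleseLeonardi2020.valence_image_intVec (C : Finset (Site d)) (z : Site d) :
    CicaleseLeonardi2020.valence (CicaleseLeonardi2020.cubicLattice d) (C.image (intVec d))
        (intVec d z) = #(((zdGraph d).neighborFinset z).filter fun w => w ∉ C) := by
  classical
  unfold CicaleseLeonardi2020.valence
  have hset : {y : EuclideanSpace ℝ (Fin d) | y ∈ CicaleseLeonardi2020.cubicLattice d ∧
        y ∉ C.image (intVec d) ∧ dist y (intVec d z) = 1} =
      ((((zdGraph d).neighborFinset z).filter fun w => w ∉ C).image (intVec d) : Set _) := by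
    ext y
    simp only [CicaleseLeonardi2020.cubicLattice_eq_range_intVec, Set.mem_range, Set.mem_setOf_eq,
      coe_image, coe_filter, Set.mem_image, Set.mem_setOf_eq, SimpleGraph.mem_neighborFinset]
    constructor
    · rintro ⟨⟨w, rfl⟩, hnot, hdist⟩
      refine ⟨w, ⟨?_, fun hw => hnot (mem_image_of_mem _ hw)⟩, rfl⟩
      rw [zdGraph_adj_iff_dist_intVec_eq_one, dist_comm]
      exact hdist
    · rintro ⟨w, ⟨hadj, hw⟩, rfl⟩
      refine ⟨⟨w, rfl⟩, ?_, ?_⟩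
      · intro hmem
        rw [mem_image] at hmem
        obtain ⟨w', hw', he⟩ := hmem
        exact hw (intVec_injective d he ▸ hw')
      · rw [dist_comm, ← zdGraph_adj_iff_dist_intVec_eq_one]
        exact hadj
  rw [hset, Set.ncard_coe_finset, card_image_of_injective _ (intVec_injective d)]

/-- **The cubic-lattice excess energy of Cicalese–Leonardi is the edge perimeter `#Θ_d` of
Mainini–Schmidt**: `E(ι C) = Σ_{x ∈ C} val(x, C) = #(boundaryPairs C)` (the number of pairs `x ∈ C`,
`y ∈ ℤ^d ∖ C`, `x ∼ y`; `card_boundaryPairs_eq_sum_card_filter_neighborFinset`).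
[cite: CicaleseLeonardi2020, §3.1 p. 6 (`E(X) = Σ_{x∈X} val(x, X)`); MaininiSchmidt2020, §1 (Θ_d)] -/
theorem CicaleseLeonardi2020.cubicExcess_image_intVec (C : Finset (Site d)) :
    CicaleseLeonardi2020.cubicExcess (C.image (intVec d)) = #(boundaryPairs C) := by
  classical
  unfold CicaleseLeonardi2020.cubicExcess
  rw [sum_image fun x _ y _ h => intVec_injective d h,
    card_boundaryPairs_eq_sum_card_filter_neighborFinset]
  exact Finset.sum_congr rfl fun z _ => CicaleseLeonardi2020.valence_image_intVec C z

/-! ### B -/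

/-- The image of a finite set of integer points lies in `ℤ^d ⊂ ℝ^d`.
[cite: CicaleseLeonardi2020, §3.1 p. 6 (`X ⊂ ℤ^d`)] -/
theorem CicaleseLeonardi2020.coe_image_intVec_subset (C : Finset (Site d)) :
    (↑(C.image (intVec d)) : Set (EuclideanSpace ℝ (Fin d))) ⊆ CicaleseLeonardi2020.cubicLattice d := by
  rw [coe_image, CicaleseLeonardi2020.cubicLattice_eq_range_intVec]
  exact Set.image_subset_range _ _

/-- **A finite `X ⊂ ℤ^d ⊂ ℝ^d` is `ι(C)` for a finite set `C` of integer points.**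
[cite: CicaleseLeonardi2020, §3.1 p. 6 (`X ∈ 𝒳_N`, `X ⊂ ℤ^d`)] -/
theorem CicaleseLeonardi2020.exists_eq_image_intVec {X : Finset (EuclideanSpace ℝ (Fin d))}
    (hX : (↑X : Set (EuclideanSpace ℝ (Fin d))) ⊆ CicaleseLeonardi2020.cubicLattice d) :
    ∃ C : Finset (Site d), X = C.image (intVec d) := by
  classical
  refine ⟨X.preimage (intVec d) (intVec_injective d).injOn, ?_⟩
  rw [Finset.image_preimage, Finset.filter_true_of_mem]
  intro x hx
  rw [← CicaleseLeonardi2020.cubicLattice_eq_range_intVec]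
  exact hX hx

/-- **Exact minimisers of the cubic excess energy are the `EIP^d` minimizers**: for `C ⊂ ℤ^d`,
`IsAlmostMinimal ℤ^d E (ι C) 0 ↔ IsEIPMinimizer C` ((2.12) with `α_N = 0`: `E(X) ≤ E(Y)` for all
`N`-point `Y ⊂ ℤ^d`, versus `#Θ_d(C) = EIP^d(#C)`).
[cite: CicaleseLeonardi2020, (2.12) p. 5 and §3.1 p. 7 ("the case `α_N = 0`"); MaininiSchmidt2020, §1
(EIP^d minimizers)] -/
theorem CicaleseLeonardi2020.isAlmostMinimal_zero_iff_isEIPMinimizer (C : Finset (Site d)) :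
    CicaleseLeonardi2020.IsAlmostMinimal (CicaleseLeonardi2020.cubicLattice d)
        (fun Y => (CicaleseLeonardi2020.cubicExcess Y : ℝ)) (C.image (intVec d)) 0 ↔
      IsEIPMinimizer C := by
  classical
  constructor
  · rintro ⟨-, hmin⟩ C' hcard
    have h := hmin (C'.image (intVec d)) (CicaleseLeonardi2020.coe_image_intVec_subset C')
      (by rw [card_image_of_injective _ (intVec_injective d),
        card_image_of_injective _ (intVec_injective d), hcard])
    simp only [add_zero, CicaleseLeonardi2020.cubicExcess_image_intVec, Nat.cast_le] at h
    exact h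
  · intro hC
    refine ⟨CicaleseLeonardi2020.coe_image_intVec_subset C, fun Y hY hcard => ?_⟩
    obtain ⟨C', rfl⟩ := CicaleseLeonardi2020.exists_eq_image_intVec hY
    rw [card_image_of_injective _ (intVec_injective d),
      card_image_of_injective _ (intVec_injective d)] at hcard
    simp only [add_zero, CicaleseLeonardi2020.cubicExcess_image_intVec, Nat.cast_le]
    exact hC C' hcard

/-! ### C: volumes -/

/-- The volume of a closed coordinate box of `EuclideanSpace ℝ (Fin d)` is the product of its side
lengths (Lebesgue measure transported along `EuclideanSpace ℝ (Fin d) ≃ᵐ (Fin d → ℝ)`; the `d = 3` case is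
`Literature.Analysis.Convexity.volume_setOf_forall_le_le_three`).
[cite: CicaleseLeonardi2020, §3.1 p. 6 (`|W_v| = v` for the cube `W_v = v^{1/d}[−½,½]^d`) — plumbing] -/
theorem volume_setOf_forall_le_and_le (lo hi : Fin d → ℝ) :
    volume {x : EuclideanSpace ℝ (Fin d) | ∀ t, lo t ≤ x t ∧ x t ≤ hi t} =
      ∏ t, ENNReal.ofReal (hi t - lo t) := by
  have h := (EuclideanSpace.volume_preserving_symm_measurableEquiv_toLp
    (Fin d)).measure_preimage_equiv (Set.Icc lo hi)
  rw [Real.volume_Icc_pi] at h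
  rw [← h]
  congr 1
  ext x
  simp [Set.mem_Icc, Pi.le_def, forall_and]

/-- The Voronoi cube `x + [−½, ½]^d` of a lattice point as a coordinate box.
[cite: CicaleseLeonardi2020, §3.1 p. 6 (`ζ(X) = ⋃ x + [−½,½]^d`)] -/
theorem CicaleseLeonardi2020.unitCubeAt_eq_setOf (x : EuclideanSpace ℝ (Fin d)) :
    CicaleseLeonardi2020.unitCubeAt x =
      {y : EuclideanSpace ℝ (Fin d) | ∀ t, x t - 1 / 2 ≤ y t ∧ y t ≤ x t + 1 / 2} := by
  ext y
  simp only [CicaleseLeonardi2020.unitCubeAt, Set.mem_setOf_eq, abs_sub_le_iff]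
  refine forall_congr' fun t => ?_
  constructor <;> rintro ⟨h1, h2⟩ <;> constructor <;> linarith

/-- **`|x + [−½, ½]^d| = 1`** (so that `|ζ(X)| = #X`). [cite: CicaleseLeonardi2020, §3.1 p. 6] -/
theorem CicaleseLeonardi2020.volume_unitCubeAt (x : EuclideanSpace ℝ (Fin d)) :
    volume (CicaleseLeonardi2020.unitCubeAt x) = 1 := by
  rw [CicaleseLeonardi2020.unitCubeAt_eq_setOf, volume_setOf_forall_le_and_le]
  simp only [show ∀ t, x t + 1 / 2 - (x t - 1 / 2) = (1 : ℝ) from fun t => by ring, ENNReal.ofReal_one,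
    prod_const_one]

/-- `|V(X)| ≤ #X` (subadditivity of Lebesgue measure over the `#X` unit cubes).
[cite: CicaleseLeonardi2020, §3.1 p. 6 (`V(X) = ⋃_{x∈X} x + [−½,½]^d`)] -/
theorem CicaleseLeonardi2020.volume_cubeUnion_le_card (X : Finset (EuclideanSpace ℝ (Fin d))) :
    volume (CicaleseLeonardi2020.cubeUnion X) ≤ (#X : ℝ≥0∞) := by
  unfold CicaleseLeonardi2020.cubeUnion
  refine (measure_biUnion_finset_le X _).trans ?_
  simp only [CicaleseLeonardi2020.volume_unitCubeAt, sum_const, nsmul_eq_mul, mul_one, le_refl]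

/-- `V(X) △ V(Y) ⊆ V(X △ Y)`: a point covered by the cubes of `X` but by no cube of `Y` lies in the cube
of a point of `X ∖ Y`. [cite: CicaleseLeonardi2020, §3.1 p. 6 (`V(X)`)] -/
theorem CicaleseLeonardi2020.cubeUnion_symmDiff_subset [DecidableEq (EuclideanSpace ℝ (Fin d))]
    (X Y : Finset (EuclideanSpace ℝ (Fin d))) :
    CicaleseLeonardi2020.cubeUnion X ∆ CicaleseLeonardi2020.cubeUnion Y ⊆
      CicaleseLeonardi2020.cubeUnion (X ∆ Y) := by
  intro y hy
  simp only [CicaleseLeonardi2020.cubeUnion, Set.mem_iUnion, exists_prop] at hy ⊢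
  rw [Set.mem_symmDiff] at hy
  simp only [Set.mem_iUnion, exists_prop, not_exists, not_and] at hy
  rcases hy with ⟨⟨x, hx, hyx⟩, hno⟩ | ⟨⟨x, hx, hyx⟩, hno⟩
  · exact ⟨x, mem_symmDiff.2 (Or.inl ⟨hx, fun hxY => hno x hxY hyx⟩), hyx⟩
  · exact ⟨x, mem_symmDiff.2 (Or.inr ⟨hx, fun hxX => hno x hxX hyx⟩), hyx⟩

/-- **`|V(X) △ V(Y)| ≤ #(X △ Y)`**: the Voronoi-cube unions of two configurations differ in measure
by at most the number of points in which the configurations differ — the bridge from Mainini–Schmidt's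
lattice-point count `#((C − a) △ W_n)` to Cicalese–Leonardi's `|V(X) △ (x + W_N)|`.
[cite: CicaleseLeonardi2020, §3.1 p. 7; MaininiSchmidt2020, Theorem 1.1 (i)] -/
theorem CicaleseLeonardi2020.volume_cubeUnion_symmDiff_le [DecidableEq (EuclideanSpace ℝ (Fin d))]
    (X Y : Finset (EuclideanSpace ℝ (Fin d))) :
    volume (CicaleseLeonardi2020.cubeUnion X ∆ CicaleseLeonardi2020.cubeUnion Y) ≤
      (#(X ∆ Y) : ℝ≥0∞) :=
  (measure_mono (CicaleseLeonardi2020.cubeUnion_symmDiff_subset X Y)).trans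
    (CicaleseLeonardi2020.volume_cubeUnion_le_card _)


/-! ### C2: the lattice Wulff cube as a continuum box -/

/-- The Voronoi-cube union of the translated lattice Wulff cube `a + W_n`, `W_n = {1,…,ℓ}^d`,
`ℓ = ⌊n^{1/d}⌋`, lies in the closed box `∏_t [a_t + ½, a_t + ℓ + ½]`.
[cite: MaininiSchmidt2020, §1 (W_n = {1,…,⌊n^{1/d}⌋}^d); CicaleseLeonardi2020, §3.1 p. 6 (`V(X)`)] -/
theorem cubeUnion_latticeCube_subset (a : Site d) (N : ℕ) :
    CicaleseLeonardi2020.cubeUnion (((wulffCube d N).image (· + a)).image (intVec d)) ⊆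
      {y : EuclideanSpace ℝ (Fin d) | ∀ t, (a t : ℝ) + 1 / 2 ≤ y t ∧
        y t ≤ (a t : ℝ) + (latticeRootFloor d N : ℝ) + 1 / 2} := by
  classical
  intro y hy
  unfold CicaleseLeonardi2020.cubeUnion at hy
  rw [Set.mem_iUnion₂] at hy
  obtain ⟨x, hx, hyx⟩ := hy
  obtain ⟨w', hw', rfl⟩ := mem_image.1 hx
  obtain ⟨w, hw, rfl⟩ := mem_image.1 hw'
  rw [CicaleseLeonardi2020.unitCubeAt_eq_setOf] at hyx
  intro t
  obtain ⟨h1, h2⟩ := hyx t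
  have hwt := (Fintype.mem_piFinset.1 hw) t
  rw [mem_Icc] at hwt
  have e : (intVec d (w + a)) t = (w t : ℝ) + a t := by
    rw [intVec_apply, Pi.add_apply, Int.cast_add]
  rw [e] at h1 h2
  have h3 : (1 : ℝ) ≤ w t := by exact_mod_cast hwt.1
  have h4 : (w t : ℝ) ≤ latticeRootFloor d N := by exact_mod_cast hwt.2
  constructor <;> linarith

/-- Conversely, for `ℓ ≥ 1` the closed box `∏_t [a_t + ½, a_t + ℓ + ½]` is covered by the Voronoi cubes
of `a + {1,…,ℓ}^d` (round each coordinate to the nearest admissible integer).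
[cite: MaininiSchmidt2020, §1 (W_n); CicaleseLeonardi2020, §3.1 p. 6 (`V(X)`)] -/
theorem subset_cubeUnion_latticeCube (a : Site d) {N : ℕ}
    (hℓ : 1 ≤ latticeRootFloor d N) :
    {y : EuclideanSpace ℝ (Fin d) | ∀ t, (a t : ℝ) + 1 / 2 ≤ y t ∧
        y t ≤ (a t : ℝ) + (latticeRootFloor d N : ℝ) + 1 / 2} ⊆
      CicaleseLeonardi2020.cubeUnion (((wulffCube d N).image (· + a)).image (intVec d)) := by
  classical
  intro y hy
  set ℓ := latticeRootFloor d N with hℓeq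
  -- the rounded lattice point
  set w : Site d := fun t => min (ℓ : ℤ) ⌊y t - a t + 1 / 2⌋ with hw
  unfold CicaleseLeonardi2020.cubeUnion
  rw [Set.mem_iUnion₂]
  refine ⟨intVec d (w + a), mem_image_of_mem _ (mem_image_of_mem _ ?_), ?_⟩
  · rw [wulffCube, Fintype.mem_piFinset]
    intro t
    rw [mem_Icc]
    obtain ⟨h1, -⟩ := hy t
    refine ⟨le_min (by exact_mod_cast hℓ) ?_, min_le_left _ _⟩
    rw [Int.le_floor]
    push_cast
    linarith
  · rw [CicaleseLeonardi2020.unitCubeAt_eq_setOf]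
    intro t
    obtain ⟨h1, h2⟩ := hy t
    have e : (intVec d (w + a)) t = (w t : ℝ) + a t := by
      rw [intVec_apply, Pi.add_apply, Int.cast_add]
    rw [e]
    have hfl := Int.floor_le (y t - a t + 1 / 2)
    have hlt := Int.lt_floor_add_one (y t - a t + 1 / 2)
    rcases le_total (ℓ : ℤ) ⌊y t - a t + 1 / 2⌋ with hle | hle
    · have hwt : w t = ℓ := by simp only [hw]; exact min_eq_left hle
      rw [hwt]
      have : (ℓ : ℝ) ≤ ⌊y t - a t + 1 / 2⌋ := by exact_mod_cast hle
      push_cast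
      constructor <;> linarith
    · have hwt : w t = ⌊y t - a t + 1 / 2⌋ := by simp only [hw]; exact min_eq_right hle
      rw [hwt]
      constructor <;> linarith

/-- **The Voronoi-cube union of the lattice Wulff cube `a + W_n` has volume `ℓ^d = #W_n`** (`d ≥ 1`;
`ℓ = ⌊n^{1/d}⌋`, the union being empty for `ℓ = 0`).
[cite: MaininiSchmidt2020, §1 (W_n); CicaleseLeonardi2020, §3.1 p. 6 (`|ζ(X)| = #X`)] -/
theorem volume_cubeUnion_latticeCube (hd : 1 ≤ d) (a : Site d) (N : ℕ) :
    volume (CicaleseLeonardi2020.cubeUnion (((wulffCube d N).image (· + a)).image (intVec d))) =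
      ENNReal.ofReal ((latticeRootFloor d N : ℝ) ^ d) := by
  classical
  rcases Nat.eq_zero_or_pos (latticeRootFloor d N) with hℓ | hℓ
  · -- empty lattice cube
    have hempty : wulffCube d N = ∅ := by
      rw [wulffCube, Fintype.piFinset_eq_empty]
      refine ⟨⟨0, hd⟩, ?_⟩
      rw [hℓ]
      decide
    rw [hempty, image_empty, image_empty, hℓ, Nat.cast_zero, zero_pow (by omega), ENNReal.ofReal_zero]
    simp [CicaleseLeonardi2020.cubeUnion]
  · rw [Set.Subset.antisymm (cubeUnion_latticeCube_subset a N)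
      (subset_cubeUnion_latticeCube a hℓ), volume_setOf_forall_le_and_le]
    simp only [show ∀ t : Fin d, (a t : ℝ) + (latticeRootFloor d N : ℝ) + 1 / 2 - ((a t : ℝ) + 1 / 2) =
      (latticeRootFloor d N : ℝ) from fun t => by ring, prod_const, card_univ, Fintype.card_fin]
    rw [ENNReal.ofReal_pow (Nat.cast_nonneg _)]

/-- The Voronoi-cube union of a finite configuration is measurable (a finite union of closed boxes).
[cite: CicaleseLeonardi2020, §2 p. 4 (`F` is defined on measurable sets; `V(X)`)] -/
theorem CicaleseLeonardi2020.measurableSet_cubeUnion (X : Finset (EuclideanSpace ℝ (Fin d))) :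
    MeasurableSet (CicaleseLeonardi2020.cubeUnion X) := by
  unfold CicaleseLeonardi2020.cubeUnion
  refine Finset.measurableSet_biUnion X fun x _ => IsClosed.measurableSet ?_
  have e : CicaleseLeonardi2020.unitCubeAt x = ⋂ t, {y : EuclideanSpace ℝ (Fin d) | |y t - x t| ≤ 1 / 2} := by
    ext y; simp [CicaleseLeonardi2020.unitCubeAt]
  rw [e]
  exact isClosed_iInter fun t => isClosed_le (by fun_prop) continuous_const

/-- The translate `v + W_N` of the continuum Wulff cube `W_N = N^{1/d}[−½,½]^d` is the coordinate box
`∏_t [v_t − N^{1/d}/2, v_t + N^{1/d}/2]`. [cite: CicaleseLeonardi2020, §3.1 p. 6 (`W_v = v^{1/d}[−½,½]^d`)] -/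
theorem CicaleseLeonardi2020.vadd_wulffCube_eq_setOf (v : EuclideanSpace ℝ (Fin d)) (N : ℕ) :
    v +ᵥ CicaleseLeonardi2020.wulffCube d N =
      {y : EuclideanSpace ℝ (Fin d) | ∀ t, v t - (N : ℝ) ^ ((1 : ℝ) / (d : ℝ)) / 2 ≤ y t ∧
        y t ≤ v t + (N : ℝ) ^ ((1 : ℝ) / (d : ℝ)) / 2} := by
  ext y
  rw [Set.mem_vadd_set_iff_neg_vadd_mem, vadd_eq_add]
  simp only [CicaleseLeonardi2020.wulffCube, Set.mem_setOf_eq, PiLp.add_apply, PiLp.neg_apply,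
    abs_le]
  refine forall_congr' fun t => ?_
  constructor <;> rintro ⟨h1, h2⟩ <;> constructor <;> linarith

/-- `|v + W_N| = N` (`d ≥ 1`). [cite: CicaleseLeonardi2020, §3.1 p. 6 (`|W_v| = v`)] -/
theorem CicaleseLeonardi2020.volume_vadd_wulffCube (hd : 1 ≤ d) (v : EuclideanSpace ℝ (Fin d)) (N : ℕ) :
    volume (v +ᵥ CicaleseLeonardi2020.wulffCube d N) = ENNReal.ofReal (N : ℝ) := by
  rw [CicaleseLeonardi2020.vadd_wulffCube_eq_setOf, volume_setOf_forall_le_and_le]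
  have hs : (0 : ℝ) ≤ (N : ℝ) ^ ((1 : ℝ) / (d : ℝ)) := Real.rpow_nonneg (Nat.cast_nonneg N) _
  simp only [show ∀ t : Fin d, v t + (N : ℝ) ^ ((1 : ℝ) / (d : ℝ)) / 2 -
      (v t - (N : ℝ) ^ ((1 : ℝ) / (d : ℝ)) / 2) = (N : ℝ) ^ ((1 : ℝ) / (d : ℝ)) from fun t => by ring,
    prod_const, card_univ, Fintype.card_fin]
  rw [← ENNReal.ofReal_pow hs, ← Real.rpow_natCast, ← Real.rpow_mul (Nat.cast_nonneg N)]
  have hd0 : (d : ℝ) ≠ 0 := by exact_mod_cast (show d ≠ 0 by omega)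
  rw [one_div_mul_cancel hd0, Real.rpow_one]

/-- **The lattice Wulff cube sits inside the continuum Wulff cube, up to volume `N − ℓ^d`**: with
`ℓ = ⌊N^{1/d}⌋`, the Voronoi-cube union `U` of `a + {1,…,ℓ}^d` and the concentric translate
`S = v + N^{1/d}[−½,½]^d`, `v_t = a_t + (ℓ+1)/2`, satisfy `U ⊆ S` and `|U △ S| = |S| − |U| = N − ℓ^d`.
[cite: MaininiSchmidt2020, §1 (W_n = {1,…,⌊n^{1/d}⌋}^d); CicaleseLeonardi2020, §3.1 p. 6 (`W_N`)] -/
theorem volume_cubeUnion_latticeCube_symmDiff_le (hd : 1 ≤ d) (a : Site d) (N : ℕ) :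
    volume (CicaleseLeonardi2020.cubeUnion (((wulffCube d N).image (· + a)).image (intVec d)) ∆
        ((WithLp.toLp 2 fun t => (a t : ℝ) + ((latticeRootFloor d N : ℝ) + 1) / 2 :
            EuclideanSpace ℝ (Fin d)) +ᵥ CicaleseLeonardi2020.wulffCube d N)) ≤
      ENNReal.ofReal ((N : ℝ) - (latticeRootFloor d N : ℝ) ^ d) := by
  classical
  set ℓ := latticeRootFloor d N with hℓ
  set U := CicaleseLeonardi2020.cubeUnion (((wulffCube d N).image (· + a)).image (intVec d)) with hU
  set v : EuclideanSpace ℝ (Fin d) := WithLp.toLp 2 fun t => (a t : ℝ) + ((ℓ : ℝ) + 1) / 2 with hv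
  set S := v +ᵥ CicaleseLeonardi2020.wulffCube d N with hS
  have hℓs : (ℓ : ℝ) ≤ (N : ℝ) ^ ((1 : ℝ) / (d : ℝ)) := Nat.floor_le (Real.rpow_nonneg (Nat.cast_nonneg N) _)
  have hUS : U ⊆ S := by
    refine (cubeUnion_latticeCube_subset a N).trans fun y hy => ?_
    rw [hS, CicaleseLeonardi2020.vadd_wulffCube_eq_setOf]
    intro t
    obtain ⟨h1, h2⟩ := hy t
    have ev : v t = (a t : ℝ) + ((ℓ : ℝ) + 1) / 2 := rfl
    rw [ev]
    constructor <;> linarith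
  rw [symmDiff_of_le hUS, measure_sdiff hUS (CicaleseLeonardi2020.measurableSet_cubeUnion _).nullMeasurableSet
    (by rw [hU, volume_cubeUnion_latticeCube hd]; exact ENNReal.ofReal_ne_top),
    hS, CicaleseLeonardi2020.volume_vadd_wulffCube hd, hU,
    volume_cubeUnion_latticeCube hd, ← ENNReal.ofReal_sub _ (pow_nonneg (Nat.cast_nonneg _) _)]

/-! ### D: exponent bookkeeping -/

/-- `a^n − b^n ≤ n a^{n−1} (a − b)` for `0 ≤ b ≤ a`. [folklore] -/
private theorem pow_sub_pow_le_mul_pow_sub (n : ℕ) {a b : ℝ} (hb : 0 ≤ b) (hab : b ≤ a) :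
    a ^ n - b ^ n ≤ n * a ^ (n - 1) * (a - b) := by
  rw [← geom_sum₂_mul a b n]
  have hsum : ∑ i ∈ range n, a ^ i * b ^ (n - 1 - i) ≤ ∑ i ∈ range n, a ^ (n - 1) := by
    refine Finset.sum_le_sum fun i hi => ?_
    rw [mem_range] at hi
    calc a ^ i * b ^ (n - 1 - i) ≤ a ^ i * a ^ (n - 1 - i) :=
          mul_le_mul_of_nonneg_left (pow_le_pow_left₀ hb hab _) (pow_nonneg (hb.trans hab) _)
      _ = a ^ (n - 1) := by rw [← pow_add]; congr 1; omega
  rw [sum_const, card_range, nsmul_eq_mul] at hsum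
  calc (∑ i ∈ range n, a ^ i * b ^ (n - 1 - i)) * (a - b) ≤ (n * a ^ (n - 1)) * (a - b) :=
        mul_le_mul_of_nonneg_right hsum (sub_nonneg.2 hab)
    _ = _ := by ring

/-- **`N − ⌊N^{1/d}⌋^d ≤ d · N^{(d−1+2^{1−d})/d}`** (`d ≥ 1`; indeed `≤ d N^{(d−1)/d}`): the volume between
the lattice and the continuum Wulff cubes is of lower order than the maximal fluctuation
(`rpow_bookkeeping`: `N^{(d−1+2^{1−d})/d} = (N^{1/d})^{d−1} N^{2^{1−d}/d}`).
[cite: MaininiSchmidt2020, Theorem 1.1 and p. 3 (the exponent `(d−1+2^{1−d})/d`)] -/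
theorem sub_latticeRootFloor_pow_le (hd : 1 ≤ d) (N : ℕ) :
    (N : ℝ) - (latticeRootFloor d N : ℝ) ^ d ≤ d * (N : ℝ) ^ maximalFluctuationExponent d := by
  rcases Nat.eq_zero_or_pos N with rfl | hN
  · have h1 : (0 : ℝ) ≤ d * ((0 : ℕ) : ℝ) ^ maximalFluctuationExponent d :=
      mul_nonneg (Nat.cast_nonneg d) (Real.rpow_nonneg (Nat.cast_nonneg 0) _)
    have h2 : (0 : ℝ) ≤ (latticeRootFloor d 0 : ℝ) ^ d := pow_nonneg (Nat.cast_nonneg _) _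
    push_cast at h1 ⊢
    linarith
  · obtain ⟨h1, h2, -, h4⟩ := rpow_bookkeeping hd hN
    set lam := (N : ℝ) ^ ((1 : ℝ) / d) with hlam
    set mu := (N : ℝ) ^ ((2 : ℝ) ^ (1 - (d : ℝ)) / d) with hmu
    have hlam0 : 0 ≤ lam := Real.rpow_nonneg (Nat.cast_nonneg N) _
    have hℓle : (latticeRootFloor d N : ℝ) ≤ lam := Nat.floor_le hlam0
    have hℓlt : lam < (latticeRootFloor d N : ℝ) + 1 := Nat.lt_floor_add_one lam
    have key := pow_sub_pow_le_mul_pow_sub d (Nat.cast_nonneg (latticeRootFloor d N)) hℓle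
    rw [h1] at key
    rw [h4]
    have hpow : 0 ≤ lam ^ (d - 1) := pow_nonneg hlam0 _
    have hd0 : (0 : ℝ) ≤ d := Nat.cast_nonneg d
    calc (N : ℝ) - (latticeRootFloor d N : ℝ) ^ d ≤ d * lam ^ (d - 1) * (lam - latticeRootFloor d N) := key
      _ ≤ d * lam ^ (d - 1) * 1 :=
          mul_le_mul_of_nonneg_left (by linarith) (mul_nonneg hd0 hpow)
      _ ≤ d * (lam ^ (d - 1) * mu) := by
          rw [mul_one]
          exact mul_le_mul_of_nonneg_left (le_mul_of_one_le_right hpow h2) hd0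

/-- The sharp exponent is below Cicalese–Leonardi's: `(d−1+2^{1−d})/d ≤ 1 − 1/(2d)` for `d ≥ 2`
(equality for `d = 2`, where both are `3/4`), hence `N^{(d−1+2^{1−d})/d} ≤ N^{1−1/(2d)}`.
[cite: CicaleseLeonardi2020, §3.1 p. 7 ("sub-optimal fluctuation estimate `N^{1−1/(2d)}`");
MaininiSchmidt2020, Theorem 1.1] -/
theorem rpow_maximalFluctuationExponent_le_rpow (hd : 2 ≤ d) (N : ℕ) :
    (N : ℝ) ^ maximalFluctuationExponent d ≤ (N : ℝ) ^ ((1 : ℝ) - 1 / (2 * (d : ℝ))) := by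
  have hd2 : (2 : ℝ) ≤ d := by exact_mod_cast hd
  have hdpos : (0 : ℝ) < d := by linarith
  have hkey : (2 : ℝ) ^ (1 - (d : ℝ)) ≤ 1 / 2 := by
    have h := Real.rpow_le_rpow_of_exponent_le (one_le_two) (show (1 : ℝ) - d ≤ -1 by linarith)
    rw [Real.rpow_neg_one] at h
    have e : (2 : ℝ)⁻¹ = 1 / 2 := by norm_num
    linarith [h, e]
  have hθ : maximalFluctuationExponent d ≤ 1 - 1 / (2 * (d : ℝ)) := by
    rw [maximalFluctuationExponent, div_le_iff₀ hdpos]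
    have e : (1 - 1 / (2 * (d : ℝ))) * d = d - 1 / 2 := by field_simp
    rw [e]
    linarith
  have hθpos : 0 < maximalFluctuationExponent d := by
    rw [maximalFluctuationExponent]
    exact div_pos (by linarith [Real.rpow_nonneg (zero_le_two) (1 - (d : ℝ))]) hdpos
  rcases Nat.eq_zero_or_pos N with rfl | hN
  · rw [Nat.cast_zero, Real.zero_rpow hθpos.ne', Real.zero_rpow (by linarith)]
  · exact Real.rpow_le_rpow_of_exponent_le (by exact_mod_cast hN) hθ

/-! ### E: assembly -/

/-- Symmetric differences commute with lattice translations: `#(C △ (W + a)) = #((C − a) △ W)` (the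
"translation vector `a ∈ ℤ^d`" of the source). [cite: MaininiSchmidt2020, Theorem 1.1 (i)] -/
theorem card_symmDiff_image_add_eq (C W : Finset (Site d)) (a : Site d) :
    #(C ∆ W.image (· + a)) = #((C.image fun x => x - a) ∆ W) := by
  classical
  have hinj : Function.Injective fun x : Site d => x - a := sub_left_injective
  rw [← card_image_of_injective (C ∆ W.image (· + a)) hinj, image_symmDiff _ _ hinj, image_image]
  congr 2
  rw [show ((fun x : Site d => x - a) ∘ fun x => x + a) = id from funext fun x => by simp, image_id]

/-- **The sharp maximal-fluctuation law for exact minimisers on `ℤ^d`, in the continuum form of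
Cicalese–Leonardi (PROVED).**  For every `d ≥ 1` there is `c_d > 0` such that for every `N` and every
`N`-point `X ⊂ ℤ^d` minimising the excess energy `E = Σ val` among `N`-point configurations,
`inf_{x ∈ ℝ^d} |V(X) △ (x + W_N)| ≤ c_d N^{(d−1+2^{1−d})/d}` (`V(X)` the union of the Voronoi unit
cubes of `X`, `W_N = N^{1/d}[−½,½]^d`).  This is Mainini–Schmidt 2020, Theorem 1.1 (i)
(`MaininiSchmidt2020_thm11_upper_holds`, lattice-point counting about the lattice cube
`{1,…,⌊N^{1/d}⌋}^d`) transported to Lebesgue measure: `|V(X) △ V(C)| ≤ #(X △ C)` and the lattice cube's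
Voronoi union differs from the concentric `W_N` by volume `N − ⌊N^{1/d}⌋^d ≤ d N^{(d−1)/d}`.  It improves
the source's `N^{1−1/(2d)}` (§3.1) to the sharp exponent for every `d ≥ 3` ("in dimension `d ≥ 3` our
method provides a sub-optimal fluctuation estimate", p. 7).
[cite: MaininiSchmidt2020, Theorem 1.1 (i); CicaleseLeonardi2020, §3.1 p. 7] -/
theorem CicaleseLeonardi2020.cubicLattice_minimizers_sharp (hd : 1 ≤ d) :
    ∃ c : ℝ, 0 < c ∧ ∀ (N : ℕ) (X : Finset (EuclideanSpace ℝ (Fin d))), X.card = N →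
      CicaleseLeonardi2020.IsAlmostMinimal (CicaleseLeonardi2020.cubicLattice d)
          (fun Y => (CicaleseLeonardi2020.cubicExcess Y : ℝ)) X 0 →
        CicaleseLeonardi2020.translationDeviation (CicaleseLeonardi2020.cubeUnion X)
            (CicaleseLeonardi2020.wulffCube d N) ≤
          ENNReal.ofReal (c * (N : ℝ) ^ maximalFluctuationExponent d) := by
  classical
  obtain ⟨K, hK, hMS⟩ := MaininiSchmidt2020_thm11_upper_holds d hd
  refine ⟨K + d, by positivity, fun N X hcard hmin => ?_⟩
  obtain ⟨C, rfl⟩ := CicaleseLeonardi2020.exists_eq_image_intVec hmin.1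
  have hC : IsEIPMinimizer C := (CicaleseLeonardi2020.isAlmostMinimal_zero_iff_isEIPMinimizer C).1 hmin
  have hcardC : #C = N := by rwa [card_image_of_injective _ (intVec_injective d)] at hcard
  obtain ⟨a, ha⟩ := hMS N C hC hcardC
  set ℓ := latticeRootFloor d N with hℓ
  set B : Finset (Site d) := (StatisticalMechanics.wulffCube d N).image (· + a) with hB
  set U := CicaleseLeonardi2020.cubeUnion (B.image (intVec d)) with hU
  set v : EuclideanSpace ℝ (Fin d) := WithLp.toLp 2 fun t => (a t : ℝ) + ((ℓ : ℝ) + 1) / 2 with hv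
  set S := v +ᵥ CicaleseLeonardi2020.wulffCube d N with hS
  have h1 : volume (CicaleseLeonardi2020.cubeUnion (C.image (intVec d)) ∆ U) ≤ (#(C ∆ B) : ℝ≥0∞) := by
    refine (CicaleseLeonardi2020.volume_cubeUnion_symmDiff_le _ _).trans (le_of_eq ?_)
    rw [← image_symmDiff _ _ (intVec_injective d), card_image_of_injective _ (intVec_injective d)]
  have h2 : volume (U ∆ S) ≤ ENNReal.ofReal ((N : ℝ) - (ℓ : ℝ) ^ d) :=
    volume_cubeUnion_latticeCube_symmDiff_le hd a N
  have hℓN : (ℓ : ℝ) ^ d ≤ N := by exact_mod_cast latticeRootFloor_pow_le hd N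
  have hCB : (#(C ∆ B) : ℝ) ≤ K * (N : ℝ) ^ maximalFluctuationExponent d := by
    rw [hB, card_symmDiff_image_add_eq]; exact ha
  have hD := sub_latticeRootFloor_pow_le hd N
  calc CicaleseLeonardi2020.translationDeviation (CicaleseLeonardi2020.cubeUnion (C.image (intVec d)))
        (CicaleseLeonardi2020.wulffCube d N)
      ≤ volume (CicaleseLeonardi2020.cubeUnion (C.image (intVec d)) ∆ S) := iInf_le _ v
    _ ≤ volume (CicaleseLeonardi2020.cubeUnion (C.image (intVec d)) ∆ U) + volume (U ∆ S) :=
        measure_symmDiff_le _ _ _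
    _ ≤ (#(C ∆ B) : ℝ≥0∞) + ENNReal.ofReal ((N : ℝ) - (ℓ : ℝ) ^ d) := add_le_add h1 h2
    _ = ENNReal.ofReal ((#(C ∆ B) : ℝ) + ((N : ℝ) - (ℓ : ℝ) ^ d)) := by
        rw [ENNReal.ofReal_add (Nat.cast_nonneg _) (sub_nonneg.2 hℓN), ENNReal.ofReal_natCast]
    _ ≤ ENNReal.ofReal ((K + d) * (N : ℝ) ^ maximalFluctuationExponent d) :=
        ENNReal.ofReal_le_ofReal (by nlinarith [hCB, hD])

/-- **Cicalese–Leonardi 2020, §3.1, the exact-minimiser law — PROVED, unconditionally.**  "In particular,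
in the case `α_N = 0` we get `inf_x |V(X) △ (x + W_N)| ≤ c_d N^{1−1/(2d)}`" for every `d ≥ 2`: the
statement of the tree's conditional corollary `cubicLattice_minimizers_of (h : CicaleseLeonardi2020_cubicLattice)`,
now without the hypothesis (from `cubicLattice_minimizers_sharp` and `(d−1+2^{1−d})/d ≤ 1 − 1/(2d)`).  The
named fact itself (almost-minimisers, `α_N > 0`) is not discharged here: it rests on the Figalli–Maggi–Pratelli
quantitative Wulff inequality (`Literature.Analysis.Convexity.FigalliMaggiPratelli2010_quantitativeWulff`).
[cite: CicaleseLeonardi2020, §3.1, last display of the subsection, p. 7] -/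
theorem CicaleseLeonardi2020.cubicLattice_minimizers (hd : 2 ≤ d) :
    ∃ c : ℝ, 0 < c ∧ ∀ (N : ℕ) (X : Finset (EuclideanSpace ℝ (Fin d))), X.card = N →
      CicaleseLeonardi2020.IsAlmostMinimal (CicaleseLeonardi2020.cubicLattice d)
          (fun Y => (CicaleseLeonardi2020.cubicExcess Y : ℝ)) X 0 →
        CicaleseLeonardi2020.translationDeviation (CicaleseLeonardi2020.cubeUnion X)
            (CicaleseLeonardi2020.wulffCube d N) ≤
          ENNReal.ofReal (c * (N : ℝ) ^ ((1 : ℝ) - 1 / (2 * (d : ℝ)))) := by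
  obtain ⟨c, hc, h⟩ := CicaleseLeonardi2020.cubicLattice_minimizers_sharp (d := d) (by omega)
  refine ⟨c, hc, fun N X hcard hmin => (h N X hcard hmin).trans (ENNReal.ofReal_le_ofReal ?_)⟩
  exact mul_le_mul_of_nonneg_left (rpow_maximalFluctuationExponent_le_rpow hd N) hc.le

/-- **The `N^{3/4}` law on `ℤ³` in continuum form (PROVED)**: exact minimisers of the excess energy on the
cubic lattice `ℤ³` satisfy `inf_{x ∈ ℝ³} |V(X) △ (x + N^{1/3}[−½,½]³)| ≤ c N^{3/4}` — the sharp law of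
Mainini–Piovano–Schmidt–Stefanelli 2019 / Mainini–Schmidt 2020 ("the `N^{3/4}` law has been proved for the
lattice `ℤ³` in [22]", Cicalese–Leonardi p. 7), here from `cubicLattice_minimizers_sharp` at `d = 3`.
[cite: MaininiSchmidt2020, Theorem 1.1 (i) (d = 3); MaininiPiovanoSchmidtStefanelli2019, Theorem 1.1;
CicaleseLeonardi2020, §3.1 p. 7] -/
theorem CicaleseLeonardi2020.cubicLattice_minimizers_three :
    ∃ c : ℝ, 0 < c ∧ ∀ (N : ℕ) (X : Finset (EuclideanSpace ℝ (Fin 3))), X.card = N →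
      CicaleseLeonardi2020.IsAlmostMinimal (CicaleseLeonardi2020.cubicLattice 3)
          (fun Y => (CicaleseLeonardi2020.cubicExcess Y : ℝ)) X 0 →
        CicaleseLeonardi2020.translationDeviation (CicaleseLeonardi2020.cubeUnion X)
            (CicaleseLeonardi2020.wulffCube 3 N) ≤
          ENNReal.ofReal (c * (N : ℝ) ^ ((3 : ℝ) / 4)) := by
  obtain ⟨c, hc, h⟩ := CicaleseLeonardi2020.cubicLattice_minimizers_sharp (d := 3) (by norm_num)
  refine ⟨c, hc, fun N X hcard hmin => ?_⟩
  have := h N X hcard hmin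
  rwa [maximalFluctuationExponent_three] at this


/-! ### F: sharpness of the exponent in continuum form (Mainini–Schmidt 2020, Theorem 1.1 (ii)) -/

/-- The open Voronoi cube `{y : |y_t − z_t| < ½ ∀ t}` of a lattice point has volume `1`.
[cite: CicaleseLeonardi2020, §3.1 p. 6 (`|ζ(X)| = #X`)] -/
theorem volume_setOf_forall_abs_sub_intVec_lt (z : Site d) :
    volume {y : EuclideanSpace ℝ (Fin d) | ∀ t, |y t - (z t : ℝ)| < 1 / 2} = 1 := by
  have h := (EuclideanSpace.volume_preserving_symm_measurableEquiv_toLp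
    (Fin d)).measure_preimage_equiv (Set.univ.pi fun t => Set.Ioo ((z t : ℝ) - 1 / 2) ((z t : ℝ) + 1 / 2))
  rw [Real.volume_pi_Ioo] at h
  simp only [show ∀ t, (z t : ℝ) + 1 / 2 - ((z t : ℝ) - 1 / 2) = (1 : ℝ) from fun t => by ring,
    ENNReal.ofReal_one, prod_const_one] at h
  have hset : {y : EuclideanSpace ℝ (Fin d) | ∀ t, |y t - (z t : ℝ)| < 1 / 2} =
      (MeasurableEquiv.toLp 2 (Fin d → ℝ)).symm ⁻¹'
        (Set.univ.pi fun t => Set.Ioo ((z t : ℝ) - 1 / 2) ((z t : ℝ) + 1 / 2)) := by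
    ext y
    simp only [Set.mem_setOf_eq, Set.mem_preimage, Set.mem_univ_pi, Set.mem_Ioo,
      MeasurableEquiv.coe_toLp_symm, abs_sub_lt_iff]
    refine forall_congr' fun t => ?_
    change _ ↔ (_ < y t ∧ y t < _)
    constructor <;> rintro ⟨h1, h2⟩ <;> constructor <;> linarith
  rw [hset, h]

/-- The open Voronoi cube of a lattice point `z` misses the closed Voronoi cube of every other lattice
point `w ≠ z` (two integers at distance `< 1` are equal). [cite: CicaleseLeonardi2020, §3.1 p. 6 (`V(X)`)] -/
theorem disjoint_openCube_unitCubeAt_intVec {z w : Site d} (hzw : z ≠ w) :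
    Disjoint {y : EuclideanSpace ℝ (Fin d) | ∀ t, |y t - (z t : ℝ)| < 1 / 2}
      (CicaleseLeonardi2020.unitCubeAt (intVec d w)) := by
  rw [Set.disjoint_left]
  intro y hy hy'
  apply hzw
  funext t
  have h1 := hy t
  have h2 : |y t - (w t : ℝ)| ≤ 1 / 2 := by simpa [CicaleseLeonardi2020.unitCubeAt] using hy' t
  have h3 : |((z t : ℝ)) - (w t : ℝ)| < 1 := by
    calc |((z t : ℝ)) - (w t : ℝ)| = |(y t - w t) - (y t - z t)| := by ring_nf
      _ ≤ |y t - w t| + |y t - z t| := abs_sub _ _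
      _ < 1 := by linarith
  have h4 : |z t - w t| < 1 := by exact_mod_cast h3
  have := abs_lt.mp h4
  omega

/-- **`#(C △ B) ≤ |V(ι C) △ V(ι B)|`** for `C, B ⊂ ℤ^d`: the open Voronoi cubes of the points of `C △ B`
are pairwise disjoint, of volume `1`, and lie in `V(ι C) △ V(ι B)`.  With
`CicaleseLeonardi2020.volume_cubeUnion_symmDiff_le` this gives `|V(ι C) △ V(ι B)| = #(C △ B)`.
[cite: CicaleseLeonardi2020, §3.1 p. 6–7 (`|V(X) △ (x + W_N)|`); MaininiSchmidt2020, Theorem 1.1 (ii)] -/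
theorem card_symmDiff_le_volume_cubeUnion_symmDiff (C B : Finset (Site d)) :
    (#(C ∆ B) : ℝ≥0∞) ≤
      volume (CicaleseLeonardi2020.cubeUnion (C.image (intVec d)) ∆
        CicaleseLeonardi2020.cubeUnion (B.image (intVec d))) := by
  classical
  set O : Site d → Set (EuclideanSpace ℝ (Fin d)) :=
    fun z => {y | ∀ t, |y t - (z t : ℝ)| < 1 / 2} with hO
  -- the open cubes are measurable (open)
  have hOmeas : ∀ z, MeasurableSet (O z) := fun z => by
    have e : O z = ⋂ t, {y : EuclideanSpace ℝ (Fin d) | |y t - (z t : ℝ)| < 1 / 2} := by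
      ext y; simp [hO]
    rw [e]
    exact MeasurableSet.iInter fun t => (isOpen_lt (by fun_prop) continuous_const).measurableSet
  -- open cube of z lies in the closed cube of ι z
  have hOsub : ∀ z, O z ⊆ CicaleseLeonardi2020.unitCubeAt (intVec d z) := fun z y hy t => by
    have := hy t
    rw [intVec_apply]
    exact this.le
  -- pairwise disjoint
  have hdisj : (↑(C ∆ B) : Set (Site d)).PairwiseDisjoint O := by
    intro z _ w _ hzw
    exact Set.disjoint_of_subset_right (hOsub w) (disjoint_openCube_unitCubeAt_intVec hzw)
  -- contained in the symmetric difference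
  have hsub : (⋃ z ∈ C ∆ B, O z) ⊆ CicaleseLeonardi2020.cubeUnion (C.image (intVec d)) ∆
      CicaleseLeonardi2020.cubeUnion (B.image (intVec d)) := by
    intro y hy
    rw [Set.mem_iUnion₂] at hy
    obtain ⟨z, hz, hyz⟩ := hy
    have key : ∀ C B : Finset (Site d), z ∈ C → z ∉ B →
        y ∈ CicaleseLeonardi2020.cubeUnion (C.image (intVec d)) \
          CicaleseLeonardi2020.cubeUnion (B.image (intVec d)) := by
      intro C B hzC hzB
      constructor
      · unfold CicaleseLeonardi2020.cubeUnion
        rw [Set.mem_iUnion₂]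
        exact ⟨intVec d z, mem_image_of_mem _ hzC, hOsub z hyz⟩
      · unfold CicaleseLeonardi2020.cubeUnion
        rw [Set.mem_iUnion₂]
        rintro ⟨x, hx, hyx⟩
        obtain ⟨w, hw, rfl⟩ := mem_image.1 hx
        have hzw : z ≠ w := fun h => hzB (h ▸ hw)
        exact Set.disjoint_left.1 (disjoint_openCube_unitCubeAt_intVec hzw) hyz hyx
    rw [mem_symmDiff] at hz
    rw [Set.mem_symmDiff]
    rcases hz with ⟨hzC, hzB⟩ | ⟨hzB, hzC⟩
    · exact Or.inl (key C B hzC hzB)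
    · exact Or.inr (key B C hzB hzC)
  calc (#(C ∆ B) : ℝ≥0∞) = ∑ z ∈ C ∆ B, volume (O z) := by
        simp only [hO, volume_setOf_forall_abs_sub_intVec_lt, sum_const, nsmul_eq_mul, mul_one]
    _ = volume (⋃ z ∈ C ∆ B, O z) := (measure_biUnion_finset hdisj fun z _ => hOmeas z).symm
    _ ≤ _ := measure_mono hsub

/-- **Any continuum Wulff cube is within volume `4d·3^{d−1} N^{(d−1)/d}` of a lattice one**: for every
`x ∈ ℝ^d` and `N ≥ 1` there is a lattice vector `a ∈ ℤ^d` with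
`|V(a + W_N^{latt}) △ (x + W_N)| ≤ 4d (⌊N^{1/d}⌋ + 2)^{d−1}` (both boxes sit in the lattice box of side
`ℓ + 2` around `a`).  This is the error made when the infimum over `x ∈ ℝ^d` of Cicalese–Leonardi is
replaced by Mainini–Schmidt's infimum over lattice translations.
[cite: MaininiSchmidt2020, Theorem 1.1 (ii) ("inf over a ∈ ℤ^d"); CicaleseLeonardi2020, §3.1 p. 7
("inf over x ∈ ℝ^d")] -/
theorem exists_volume_cubeUnion_latticeCube_symmDiff_vadd_le (hd : 1 ≤ d) (x : EuclideanSpace ℝ (Fin d))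
    (N : ℕ) :
    ∃ a : Site d, volume (CicaleseLeonardi2020.cubeUnion (((wulffCube d N).image (· + a)).image (intVec d)) ∆
        (x +ᵥ CicaleseLeonardi2020.wulffCube d N)) ≤
      ENNReal.ofReal (4 * d * ((latticeRootFloor d N : ℝ) + 2) ^ (d - 1)) := by
  classical
  set ℓ := latticeRootFloor d N with hℓ
  set s := (N : ℝ) ^ ((1 : ℝ) / (d : ℝ)) with hs
  have hs0 : 0 ≤ s := Real.rpow_nonneg (Nat.cast_nonneg N) _
  have hℓs : (ℓ : ℝ) ≤ s := Nat.floor_le hs0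
  have hsℓ : s < (ℓ : ℝ) + 1 := Nat.lt_floor_add_one s
  -- the lattice anchor
  set a : Site d := fun t => ⌊x t - s / 2 + 1 / 2⌋ with ha
  refine ⟨a, ?_⟩
  set U := CicaleseLeonardi2020.cubeUnion (((wulffCube d N).image (· + a)).image (intVec d)) with hU
  set S := x +ᵥ CicaleseLeonardi2020.wulffCube d N with hS
  -- the big lattice-aligned box of side ℓ + 2
  set Big := {y : EuclideanSpace ℝ (Fin d) | ∀ t, (a t : ℝ) - 1 / 2 ≤ y t ∧ y t ≤ (a t : ℝ) + ℓ + 3 / 2}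
    with hBig
  have hUB : U ⊆ Big := by
    refine (cubeUnion_latticeCube_subset a N).trans fun y hy t => ?_
    obtain ⟨h1, h2⟩ := hy t
    constructor <;> linarith
  have hSB : S ⊆ Big := by
    intro y hy t
    rw [hS, CicaleseLeonardi2020.vadd_wulffCube_eq_setOf] at hy
    obtain ⟨h1, h2⟩ := hy t
    have h3 := Int.floor_le (x t - s / 2 + 1 / 2)
    have h4 := Int.lt_floor_add_one (x t - s / 2 + 1 / 2)
    have e : (a t : ℝ) = ((⌊x t - s / 2 + 1 / 2⌋ : ℤ) : ℝ) := rfl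
    rw [e]
    constructor <;> linarith
  have hBigvol : volume Big = ENNReal.ofReal (((ℓ : ℝ) + 2) ^ d) := by
    rw [hBig, volume_setOf_forall_le_and_le]
    simp only [show ∀ t : Fin d, (a t : ℝ) + ℓ + 3 / 2 - ((a t : ℝ) - 1 / 2) = (ℓ : ℝ) + 2 from
      fun t => by ring, prod_const, card_univ, Fintype.card_fin]
    rw [ENNReal.ofReal_pow (by positivity)]
  have hUvol : volume U = ENNReal.ofReal ((ℓ : ℝ) ^ d) := volume_cubeUnion_latticeCube hd a N
  have hSvol : volume S = ENNReal.ofReal (N : ℝ) := CicaleseLeonardi2020.volume_vadd_wulffCube hd x N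
  have hUmeas : MeasurableSet U := CicaleseLeonardi2020.measurableSet_cubeUnion _
  have hSmeas : MeasurableSet S := by
    rw [hS, CicaleseLeonardi2020.vadd_wulffCube_eq_setOf]
    have e : {y : EuclideanSpace ℝ (Fin d) | ∀ t, x t - (N : ℝ) ^ ((1 : ℝ) / (d : ℝ)) / 2 ≤ y t ∧
        y t ≤ x t + (N : ℝ) ^ ((1 : ℝ) / (d : ℝ)) / 2} =
        ⋂ t, ({y : EuclideanSpace ℝ (Fin d) | x t - (N : ℝ) ^ ((1 : ℝ) / (d : ℝ)) / 2 ≤ y t} ∩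
          {y | y t ≤ x t + (N : ℝ) ^ ((1 : ℝ) / (d : ℝ)) / 2}) := by
      ext y; simp
    rw [e]
    exact MeasurableSet.iInter fun t =>
      ((isClosed_le continuous_const (by fun_prop)).measurableSet.inter
        (isClosed_le (by fun_prop) continuous_const).measurableSet)
  -- |U △ S| ≤ |Big \ U| + |Big \ S|
  have hsub : U ∆ S ⊆ (Big \ U) ∪ (Big \ S) := by
    intro y hy
    rw [Set.mem_symmDiff] at hy
    rcases hy with ⟨hyU, hyS⟩ | ⟨hyS, hyU⟩
    · exact Or.inr ⟨hUB hyU, hyS⟩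
    · exact Or.inl ⟨hSB hyS, hyU⟩
  have hℓN : (ℓ : ℝ) ^ d ≤ N := by exact_mod_cast latticeRootFloor_pow_le hd N
  have h1 : volume (Big \ U) = ENNReal.ofReal (((ℓ : ℝ) + 2) ^ d - (ℓ : ℝ) ^ d) := by
    rw [measure_sdiff hUB hUmeas.nullMeasurableSet (by rw [hUvol]; exact ENNReal.ofReal_ne_top), hBigvol,
      hUvol, ← ENNReal.ofReal_sub _ (pow_nonneg (Nat.cast_nonneg _) _)]
  have h2 : volume (Big \ S) = ENNReal.ofReal (((ℓ : ℝ) + 2) ^ d - N) := by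
    rw [measure_sdiff hSB hSmeas.nullMeasurableSet (by rw [hSvol]; exact ENNReal.ofReal_ne_top), hBigvol,
      hSvol, ← ENNReal.ofReal_sub _ (Nat.cast_nonneg _)]
  have hgrowth : ((ℓ : ℝ) + 2) ^ d - (ℓ : ℝ) ^ d ≤ d * ((ℓ : ℝ) + 2) ^ (d - 1) * 2 := by
    have := pow_sub_pow_le_mul_pow_sub d (Nat.cast_nonneg ℓ) (by linarith : (ℓ : ℝ) ≤ ℓ + 2)
    simpa using this
  calc volume (U ∆ S) ≤ volume ((Big \ U) ∪ (Big \ S)) := measure_mono hsub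
    _ ≤ volume (Big \ U) + volume (Big \ S) := measure_union_le _ _
    _ = ENNReal.ofReal (((ℓ : ℝ) + 2) ^ d - (ℓ : ℝ) ^ d) + ENNReal.ofReal (((ℓ : ℝ) + 2) ^ d - N) := by
        rw [h1, h2]
    _ ≤ ENNReal.ofReal (((ℓ : ℝ) + 2) ^ d - (ℓ : ℝ) ^ d) + ENNReal.ofReal (((ℓ : ℝ) + 2) ^ d - (ℓ : ℝ) ^ d) :=
        add_le_add le_rfl (ENNReal.ofReal_le_ofReal (by linarith))
    _ = ENNReal.ofReal (2 * (((ℓ : ℝ) + 2) ^ d - (ℓ : ℝ) ^ d)) := by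
        have hnn : 0 ≤ ((ℓ : ℝ) + 2) ^ d - (ℓ : ℝ) ^ d :=
          sub_nonneg.2 (pow_le_pow_left₀ (Nat.cast_nonneg _) (by linarith) d)
        rw [two_mul, ENNReal.ofReal_add hnn hnn]
    _ ≤ ENNReal.ofReal (4 * d * ((ℓ : ℝ) + 2) ^ (d - 1)) := ENNReal.ofReal_le_ofReal (by nlinarith [hgrowth])

/-- **Sharpness of the exponent in continuum form (PROVED): Mainini–Schmidt 2020, Theorem 1.1 (ii),
transported to Cicalese–Leonardi's setting.**  For every `d ≥ 2` there is `c > 0` such that for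
infinitely many `N` there is an exact minimiser `X ⊂ ℤ^d`, `#X = N`, of the excess energy with
`inf_{x ∈ ℝ^d} |V(X) △ (x + W_N)| ≥ c N^{(d−1+2^{1−d})/d}`.  Hence the exponent of
`cubicLattice_minimizers_sharp` cannot be lowered: the maximal fluctuation of exact minimisers about the
Wulff cube on `ℤ^d`, measured as in [CicaleseLeonardi2020] §3.1, is EXACTLY of order `N^{(d−1+2^{1−d})/d}`
along a subsequence (`N^{3/4}` for `d = 2, 3`; "in dimension 2, we obtain the optimal fluctuation estimate
`N^{3/4}`", p. 7).  Proof: `MaininiSchmidt2020_thm11_lower_holds` (lattice count `≥ (K − ε) N^θ` for ALL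
lattice translations), `card_symmDiff_le_volume_cubeUnion_symmDiff` and the rounding error
`exists_volume_cubeUnion_latticeCube_symmDiff_vadd_le` (`O(N^{(d−1)/d}) = o(N^θ)`).
[cite: MaininiSchmidt2020, Theorem 1.1 (ii); CicaleseLeonardi2020, §3.1 p. 7] -/
theorem CicaleseLeonardi2020.cubicLattice_minimizers_sharp_lower (hd : 2 ≤ d) :
    ∃ c : ℝ, 0 < c ∧ {N : ℕ | ∃ X : Finset (EuclideanSpace ℝ (Fin d)), X.card = N ∧
      CicaleseLeonardi2020.IsAlmostMinimal (CicaleseLeonardi2020.cubicLattice d)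
          (fun Y => (CicaleseLeonardi2020.cubicExcess Y : ℝ)) X 0 ∧
        ENNReal.ofReal (c * (N : ℝ) ^ maximalFluctuationExponent d) ≤
          CicaleseLeonardi2020.translationDeviation (CicaleseLeonardi2020.cubeUnion X)
            (CicaleseLeonardi2020.wulffCube d N)}.Infinite := by
  classical
  have hd1 : 1 ≤ d := by omega
  obtain ⟨K, hK, hMS⟩ := MaininiSchmidt2020_thm11_lower_holds d hd
  have hInf := hMS (K / 4) (by positivity)
  refine ⟨K / 4, by positivity, ?_⟩
  -- the error constant and the threshold
  set E : ℝ := 4 * d * 3 ^ (d - 1) with hE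
  have hE0 : 0 < E := by positivity
  set e : ℝ := (2 : ℝ) ^ (1 - (d : ℝ)) / d with he
  have he0 : 0 < e := by
    rw [he]; exact div_pos (Real.rpow_pos_of_pos two_pos _) (by exact_mod_cast (show 0 < d by omega))
  set M : ℝ := 2 * E / K with hM
  have hM0 : 0 ≤ M := by positivity
  -- for N ≥ N₀, the second factor mu = N^e exceeds M
  obtain ⟨N₀, hN₀⟩ : ∃ N₀ : ℕ, ∀ N : ℕ, N₀ ≤ N → M ≤ (N : ℝ) ^ e := by
    obtain ⟨N₀, hN₀⟩ := exists_nat_ge (M ^ (1 / e))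
    refine ⟨N₀, fun N hN => ?_⟩
    have h1 : M ^ (1 / e) ≤ (N : ℝ) := hN₀.trans (by exact_mod_cast hN)
    have h2 := Real.rpow_le_rpow (Real.rpow_nonneg hM0 _) h1 he0.le
    rwa [← Real.rpow_mul hM0, one_div_mul_cancel he0.ne', Real.rpow_one] at h2
  refine Set.infinite_of_forall_exists_gt fun m => ?_
  obtain ⟨n, hnS, hnm⟩ := hInf.exists_gt (max m N₀)
  obtain ⟨C, hC, hcard, hcount⟩ := hnS
  refine ⟨n, ⟨C.image (intVec d), by rw [card_image_of_injective _ (intVec_injective d), hcard],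
    (CicaleseLeonardi2020.isAlmostMinimal_zero_iff_isEIPMinimizer C).2 hC, ?_⟩,
    lt_of_le_of_lt (le_max_left _ _) hnm⟩
  have hnN₀ : N₀ ≤ n := (le_max_right _ _).trans hnm.le
  have hn1 : 1 ≤ n := by
    have : m < n := lt_of_le_of_lt (le_max_left _ _) hnm
    omega
  obtain ⟨h1, h2, -, h4⟩ := rpow_bookkeeping hd1 hn1
  set lam := (n : ℝ) ^ ((1 : ℝ) / d) with hlam
  set mu := (n : ℝ) ^ ((2 : ℝ) ^ (1 - (d : ℝ)) / d) with hmu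
  have hmuM : M ≤ mu := hN₀ n hnN₀
  have hlam1 : 1 ≤ lam := by
    rw [hlam]; exact Real.one_le_rpow (by exact_mod_cast hn1) (by positivity)
  have hℓlam : (latticeRootFloor d n : ℝ) ≤ lam := Nat.floor_le (by linarith)
  -- the lower bound for every continuum translation
  refine le_iInf fun x => ?_
  obtain ⟨a, ha⟩ := exists_volume_cubeUnion_latticeCube_symmDiff_vadd_le hd1 x n
  set B : Finset (Site d) := (StatisticalMechanics.wulffCube d n).image (· + a) with hB
  set U := CicaleseLeonardi2020.cubeUnion (B.image (intVec d)) with hU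
  set S := x +ᵥ CicaleseLeonardi2020.wulffCube d n with hS
  set V := CicaleseLeonardi2020.cubeUnion (C.image (intVec d)) with hV
  have hcnt : (K - K / 4) * (n : ℝ) ^ maximalFluctuationExponent d ≤ (#(C ∆ B) : ℝ) := by
    rw [hB, card_symmDiff_image_add_eq]; exact hcount a
  -- #(C △ B) ≤ |V △ U| ≤ |V △ S| + |S △ U|
  have hchain : (#(C ∆ B) : ℝ≥0∞) ≤ volume (V ∆ S) +
      ENNReal.ofReal (4 * d * ((latticeRootFloor d n : ℝ) + 2) ^ (d - 1)) :=
    calc (#(C ∆ B) : ℝ≥0∞) ≤ volume (V ∆ U) := card_symmDiff_le_volume_cubeUnion_symmDiff C B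
      _ ≤ volume (V ∆ S) + volume (S ∆ U) := measure_symmDiff_le _ _ _
      _ ≤ volume (V ∆ S) + ENNReal.ofReal (4 * d * ((latticeRootFloor d n : ℝ) + 2) ^ (d - 1)) := by
          rw [symmDiff_comm S U]; exact add_le_add le_rfl ha
  -- real arithmetic: the error is at most (K/2) n^θ
  have herr : 4 * d * ((latticeRootFloor d n : ℝ) + 2) ^ (d - 1) ≤
      K / 2 * (n : ℝ) ^ maximalFluctuationExponent d := by
    have hA : ((latticeRootFloor d n : ℝ) + 2) ^ (d - 1) ≤ (3 * lam) ^ (d - 1) :=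
      pow_le_pow_left₀ (by positivity) (by linarith) _
    rw [mul_pow] at hA
    rw [h4]
    have hK2 : E ≤ K / 2 * mu := by
      have : M * K / 2 = E := by rw [hM]; field_simp
      nlinarith [hmuM, hK.le]
    have hlampow : 0 ≤ lam ^ (d - 1) := by positivity
    calc 4 * (d : ℝ) * ((latticeRootFloor d n : ℝ) + 2) ^ (d - 1)
        ≤ 4 * d * (3 ^ (d - 1) * lam ^ (d - 1)) :=
          mul_le_mul_of_nonneg_left hA (by positivity)
      _ = E * lam ^ (d - 1) := by rw [hE]; ring
      _ ≤ K / 2 * mu * lam ^ (d - 1) := mul_le_mul_of_nonneg_right hK2 hlampow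
      _ = K / 2 * (lam ^ (d - 1) * mu) := by ring
  have hθ0 : 0 ≤ (n : ℝ) ^ maximalFluctuationExponent d := Real.rpow_nonneg (Nat.cast_nonneg n) _
  -- conclude in ℝ≥0∞
  have hreal : K / 4 * (n : ℝ) ^ maximalFluctuationExponent d ≤
      (#(C ∆ B) : ℝ) - 4 * d * ((latticeRootFloor d n : ℝ) + 2) ^ (d - 1) := by
    nlinarith [hcnt, herr, hθ0, hK]
  calc ENNReal.ofReal (K / 4 * (n : ℝ) ^ maximalFluctuationExponent d)
      ≤ ENNReal.ofReal ((#(C ∆ B) : ℝ) - 4 * d * ((latticeRootFloor d n : ℝ) + 2) ^ (d - 1)) :=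
        ENNReal.ofReal_le_ofReal hreal
    _ = (#(C ∆ B) : ℝ≥0∞) - ENNReal.ofReal (4 * d * ((latticeRootFloor d n : ℝ) + 2) ^ (d - 1)) := by
        rw [ENNReal.ofReal_sub _ (by positivity), ENNReal.ofReal_natCast]
    _ ≤ volume (V ∆ S) := tsub_le_iff_right.2 hchain

end Literature.MathematicalPhysics.StatisticalMechanics

end
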